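import Literature.NumberTheory.Automorphic.ArthurClozelFibresRepData
import Literature.NumberTheory.Automorphic.LanglandsTetrahedralProofs
import Literature.NumberTheory.Automorphic.AutomorphicGaloisConjProofs
import Literature.NumberTheory.Automorphic.PairLFunctionBaseChangeAutomorphic
import Literature.NumberTheory.Automorphic.StrongMultiplicityOneRankinSelberg
import Literature.NumberTheory.Automorphic.AdelicGroupDataUniquenessProofs
import Literature.NumberTheory.Automorphic.AdelicGroupDataAutomorphicMeasureProofs
import HarnessLib

/-!
# Arthur–Clozel, Ch. 3, Thm. 4.2 (d) for Borel–Jacquet data: the named fact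
# `cuspidal_descent_cyclic` from its `L²` twin and the standard leaves

Topic `NumberTheory/Automorphic`; a proof file (theorems only: no definition, no named fact, no
instance). The named fact `Literature.NumberTheory.Automorphic.cuspidal_descent_cyclic` of
`TunnellOctahedralGlobal` — Arthur–Clozel, *Simple algebras, base change, and the advanced theory
of the trace formula*, Ann. of Math. Stud. 120 (1989), Ch. 3, Thm. 4.2 (d), existence clause
("Assume `Π` is cuspidal, `Π ≅ Π ∘ σ`. Then there is `π` cuspidal lifting to `Π`"), rendered for
cuspidal automorphic representations in the Borel–Jacquet model `CuspidalAutomorphicRepData`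
(arbitrary central character; hypothesis `Π ≅ Π ∘ σ` through its almost-everywhere Satake shadow
`IsGaloisStableSatakeAE`; conclusion a weak lift in the sense of Def. 1.1,
`IsWeakBaseChangeLiftAE`), one of the eleven leaves of `langlands_tunnell_of_leaves`
(`LanglandsTunnellReduction`) — is **proved here from its `L²` twin and the standard leaves of the
tree**, so that the two renderings of Thm. 4.2 (d) on the tree are no longer independent debts:

* the `L²` rendering `ArthurClozel1989_exists_cuspidal_descent_of_isGalStable`
  (`AutomorphicGaloisConj`; the clause whose printed proof is the comparison (4.1) = (4.2) of the
  trace formulae, Ch. 2 (17.8) — provefact triage XL, kept as the one trace-formula leaf);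
* strong multiplicity one over `E` in the form the tree derives it
  (`CuspidalAutomorphicRepGL.eq_of_isSatakeFamilyOf_of_jacquetShalika`,
  `StrongMultiplicityOneRankinSelberg`): multiplicity one on `L²_cusp(GL_n)` (`multiplicity_one_gl`)
  and the Jacquet–Shalika boundary facts (2.2), (2.3)
  (`JacquetShalika1981_partialPairL_at_one_of_ne_conj`, `…_pole_of_eq_conj`) — this is the
  "`Π ≅ Π ∘ σ` ⟺ `t_{Π,σw} = t_{Π,w}` a.e." folded into the statement of `cuspidal_descent_cyclic`
  (Arthur–Clozel (2.4) = Jacquet–Shalika 1981, Thm. 4.4);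
* the Borel–Jacquet dictionary between cuspidal data and `L²_cusp`, in both directions
  (`AutomorphicRepsGL.exists_isAssociatedL2`, `AutomorphicRepsGL.exists_cuspidalRepData_of_L2`,
  `hasSatakeParamAt_iff_L2`, `cuspidal_W'_eq_bot` of `AutomorphicRepsGL`; Borel–Jacquet 1979,
  4.4–4.6, 5.7).

Everything else is a theorem of the tree: the automorphic measure on
`GL_n(𝔸_E) ⧸ A_G GL_n(E)` (`exists_isAutomorphicMeasure_gl_holds`) and its uniqueness, whence its
`Gal(E/F)`-invariance (`isGalInvariant_of_unique`, `isAutomorphicMeasure_unique_smul_holds`); the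
unitary normalisation "we may assume `Π` unitary" (`CuspidalAutomorphicRepData.exists_satake_eq_cpow_mul_L2`
of `ArthurClozelFibresRepData`: `t_{Π,w} = q_w^{s} t_{Q,w}` with `Q ≤ L²_cusp`); Galois conjugates
`U_σ(Q)` and their Hecke matrices (`AutomorphicGaloisConj`); relation (1.1) for Satake families
(`IsWeakBaseChangeLift.eventually_map_pow_eq`); the twist `π' ⊗ |det|^{-s}` in the Borel–Jacquet
model and its Satake parameters (`AutomorphicTwistNorm`); Flath's Satake facts
(`hasSatakeParamAt_unique_holds`, `…_cofinite_holds`, `exists_isSatakeFamilyOf_holds`).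

Contents:

* `residueCard_cpow_mul_residueCard_under_cpow_neg_pow` — `q_w^{s} (q_v^{-s})^{f(w|v)} = 1`
  (`q_w = q_v^{f}`): the twists `|det|_{𝔸_F}^{s}`, `|det|_{𝔸_E}^{s}` respect relation (1.1).
* `IsSatakeFamilyOf.galConj` — `w ↦ t_{Π, σ⁻¹ w}` is a Satake family of `U_σ(Π)`.
* `CuspidalAutomorphicRepGL.isGalStable_of_isSatakeFamilyOf_smul` — **`σ`-invariant Hecke matrices
  a.e. ⟹ `U_σ(Π) = Π`**, granted strong multiplicity one in Satake-family form.
* `CuspidalAutomorphicRepData.exists_satake_eq_cpow_mul_L2_isGalStable` — the unitary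
  normalisation `Q` of a Borel–Jacquet datum with `Gal(E/F)`-stable Satake data is `σ`-stable for
  every `σ`.
* `cuspidal_descent_cyclic_of_leaves` — **the named fact from the eight leaves above.** Proof, for
  `n ≥ 1`: normalise `Π` to `Q ≤ L²_cusp` over `E` (`t_Π = q^{s} t_Q`), `σ`-stable by the above;
  descend `Q` to a cuspidal `P' ≤ L²_cusp` over `F` (the `L²` fact); realise `P'` by a datum `π'`
  (`exists_cuspidalRepData_of_L2`, same Hecke matrices by `hasSatakeParamAt_iff_L2`); put
  `π = π' ⊗ |det|^{-s}`; then at almost every `w ∣ v`,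
  `t_{Π,w} = q_w^{s} t_{Q,w} = q_w^{s} (t_{P',v})^{f} = q_w^{s} (q_v^{-s} t_{π,v})^{f} = (t_{π,v})^{f}`.
  For `n = 0` every cuspidal datum over `F` (one exists: `nonempty_cuspidalAutomorphicRepGL_zero`
  with `exists_cuspidalRepData_of_L2`) descends `Π`, all Satake parameters being empty.
  **Vacuous** in its leaf `cuspidal_W'_eq_bot` — see the caveat below.
* `CuspidalAutomorphicRepData.isGalStable_of_satake_eq_cpow_mul`,
  `…exists_satake_eq_cpow_mul_L2_isGalStable_of_clean` — `σ`-stability of any unitary normalisation,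
  and the normalisation with `σ`-stability from a clean model.
* `cuspidal_descent_cyclic_of_normalisation` — **the core reduction**, with the unitary normalisation
  of cuspidal data over `E` as a hypothesis `hN` (as in `ArthurClozel_fibres_quadratic_of_normalisation`).
* **`cuspidal_descent_cyclic_of_clean_leaves`** — **the live reduction**: the named fact from the seven
  leaves `hdesc`, `hm1`, `h22`, `h23`, `hA`, `hB`, `hL2` and clean models for `n ≥ 1` (in the weak, true
  form shared with `JacquetShalika_eq_of_rsData_eq_of_L2` and `ArthurClozel_fibres_quadratic_of_leaves'`,
  supplied by the named fact `AutomorphicRepsGL.stable_cuspidal_eq_sSup_irreducible` through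
  `CuspidalAutomorphicRepData.exists_clean_hasSatakeParamAt_of_sSup_irreducible` of
  `AutomorphicRepsGLCleanModel`).

## Caveat and repair (clean models instead of complements)

The first reduction (`exists_satake_eq_cpow_mul_L2_isGalStable`, `cuspidal_descent_cyclic_of_leaves`)
consumed the dictionary leaf `cuspidal_W'_eq_bot` ("a cuspidal `W / W'` is realised on a stable
*complement* of `W'`") in the family form `∀ n K hK, cuspidal_W'_eq_bot hK`, which is meanwhile
**refuted** in the tree (`not_forall_cuspidal_W'_eq_bot`, `AutomorphicRepsGLLogDetCounterexample`:
Borel–Jacquet's cusp forms carry no condition at the split centre `A_G` and are not semisimple there;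
on `GL_1` the datum `span {log ‖·‖_𝔸, 1} / ℂ·1` has no stable complement). Those theorems keep their
statements but are vacuous in that hypothesis. The proof only uses the unitary normalisation of `Π`,
which holds as soon as `Π` has the Satake parameters of a *clean* cuspidal datum
(`CuspidalAutomorphicRepData.exists_satake_eq_cpow_mul_L2_of_clean`, `LanglandsTetrahedralProofs`), and
every cuspidal datum has a clean model by the semisimplicity of `A_G`-*invariant* cusp forms
(`CuspidalAutomorphicRepData.exists_clean_hasSatakeParamAt_of_sSup_irreducible`, `AutomorphicRepsGLCleanModel`).
The repair makes the normalisation a hypothesis `hN` of the core reduction and feeds it from the true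
leaves; `cuspidal_descent_cyclic_holds` is `cuspidal_descent_cyclic_of_clean_leaves` fed with the
discharges of its seven named leaves and the clean models, once they exist.

## References

* J. Arthur, L. Clozel, *Simple algebras, base change, and the advanced theory of the trace
  formula*, Ann. of Math. Stud. 120 (1989), Ch. 3: §1 (1.1), Def. 1.1; §2 (2.4); Thm. 4.2 (d)
  (book p. 203) and its proof, §4 ("We now prove the 'going down' part of the theorem, starting
  with (d)"); held copy `book:arthur1989-simple-algebras-base-change-advanced-theory-trace`, PDF
  chunks 171 (Def. 1.1), 172 ((2.4)), 173 (Thm. 4.2), 177 (proof of (d)). [ArthurClozelAMS120]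
* H. Jacquet, J. A. Shalika, *On Euler products and the classification of automorphic forms II*,
  Amer. J. Math. 103 (1981), 777–815, Thm. 4.4. [JacquetShalika1981]
* A. Borel, H. Jacquet, *Automorphic forms and automorphic representations*, Proc. Sympos. Pure
  Math. 33 (1979), part 1, §4.4–4.6, 5.7. [BorelJacquetCorvallis1979]
* J. R. Getz, H. Hahn, *An Introduction to Automorphic Representations*, GTM 300 (2024), Thm. 6.5.1,
  Cor. 9.1.2 (semisimplicity of `𝒜_cusp^{A_G}`). [GetzHahn2024]
-/

noncomputable section

open scoped MatrixGroups NNReal Classical Pointwise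
open NumberField IsDedekindDomain MeasureTheory Filter

namespace Literature.NumberTheory.Automorphic

open AdelicGroupData

/-! ### An identity of residue cardinalities: `q_w^{s} (q_v^{-s})^{f(w|v)} = 1` -/

section ResidueCard

variable {F : Type} [Field F] [NumberField F] {E : Type} [Field E] [NumberField E] [Algebra F E]

/-- **`q_w^{s} · (q_v^{-s})^{f(w|v)} = 1`** for a finite place `w` of `E` over the place `v` of `F`
(`q_w = q_v^{f(w|v)}`, `residueCard_eq_pow_inertiaDeg`): the twists `|det|_{𝔸_F}^{s}` and
`|det|_{𝔸_E}^{s}` are compatible with the lifting identity (1.1) `t_{Π,w} = (t_{π,v})^{f(w|v)}`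
(Arthur–Clozel 1989, Ch. 3, §1). [folklore] -/
theorem residueCard_cpow_mul_residueCard_under_cpow_neg_pow (w : HeightOneSpectrum (𝓞 E)) (s : ℂ) :
    (w.residueCard : ℂ) ^ s *
      ((((w.under (𝓞 F)).residueCard : ℂ) ^ (-s)) ^ w.asIdeal.inertiaDeg (𝓞 F)) = 1 := by
  have hq : ((w.under (𝓞 F)).residueCard : ℂ) ≠ 0 := by
    have := (w.under (𝓞 F)).one_lt_residueCard
    exact_mod_cast (by omega : (w.under (𝓞 F)).residueCard ≠ 0)
  have hqs : ((w.under (𝓞 F)).residueCard : ℂ) ^ s ≠ 0 := fun h0 =>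
    hq ((Complex.cpow_eq_zero_iff _ _).1 h0).1
  rw [residueCard_eq_pow_inertiaDeg (F := F) w, natCast_pow_cpow, ← mul_pow, Complex.cpow_neg,
    mul_inv_cancel₀ hqs, one_pow]

end ResidueCard

/-! ### Galois conjugates: Satake families and `σ`-stability from `σ`-invariant Hecke matrices -/

section GalConj

variable (F : Type) [Field F] {E : Type} [Field E] [NumberField E] [Algebra F E]
  {n : ℕ} {ν : Measure (gl n E).automorphicQuotient} [(gl n E).IsAutomorphicMeasure ν]

/-- **The Satake family of a Galois conjugate**: if `A` is a Satake family of the cuspidal `Π`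
away from `S`, then `w ↦ A (σ⁻¹ w)` is a Satake family of `U_σ(Π) = Π^{σ⁻¹}` away from `σ S`
(`t_{U_σ(Π), w} = t_{Π, σ⁻¹ w}`, `HasSatakeParameterAt.galConj_principalCongruenceLevel`, at the
level `K(σ 𝔫)`, `σ⁻¹ w ∤ 𝔫 ↔ w ∤ σ 𝔫`; Arthur–Clozel 1989, Ch. 1 §2.1 for `Π^σ := Π ∘ σ`,
`t_{Π^τ, w} = t_{Π, τ w}`). [folklore] -/
theorem IsSatakeFamilyOf.galConj {Q : CuspidalAutomorphicRepGL n E ν}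
    {S : Set (HeightOneSpectrum (𝓞 E))} {A : SatakeFamily E} (hA : IsSatakeFamilyOf Q S A)
    (hν : IsGalInvariant F ν) (σ : E ≃ₐ[F] E) :
    IsSatakeFamilyOf (Q.galConj F hν σ) ((σ⁻¹ • ·) ⁻¹' S) (fun w => A (σ⁻¹ • w)) := by
  intro w hw
  obtain ⟨𝔫, h𝔫, hdvd, ϖ, h⟩ := hA (σ⁻¹ • w) hw
  have h' := h.galConj_principalCongruenceLevel F hν σ
  refine ⟨σ • 𝔫, ?_, ?_, ?_⟩
  · intro h0
    rw [Submodule.zero_eq_bot] at h0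
    exact h𝔫 ((Ideal.smul_eq_bot_iff σ 𝔫).mp h0)
  · intro hd
    apply hdvd
    have key := (HeightOneSpectrum.smul_asIdeal_pow_dvd_smul_iff σ (σ⁻¹ • w) 𝔫 1).mp
    rw [smul_inv_smul, pow_one, pow_one] at key
    exact key hd
  · have hex : ∃ ϖ' : ((σ • (σ⁻¹ • w)).adicCompletion E)ˣ,
        HasSatakeParameterAt (Q.1.galConj hν σ) (principalCongruenceLevel n E (σ • 𝔫))
          (σ • (σ⁻¹ • w)) ϖ' (A (σ⁻¹ • w)) := ⟨_, h'⟩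
    rw [smul_inv_smul] at hex
    exact hex

/-- **`σ`-stability from `σ`-invariance of the Hecke matrices** ("`Π ≅ Π ∘ σ`" from
`t_{Π, σ w} = t_{Π, w}` for almost all `w`, by strong multiplicity one; Arthur–Clozel 1989, Ch. 3,
§2 (2.4) = Jacquet–Shalika 1981, Thm. 4.4, with multiplicity one on `L²_cusp`). If a Satake family
`A` of the cuspidal `Π ≤ L²_cusp(GL_n(𝔸_E) ⧸ A_G GL_n(E), ν)` off a finite `S` satisfies
`A (σ⁻¹ w) = A w` for almost all `w`, then `U_σ(Π) = Π`, granted strong multiplicity one over `E`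
in Satake-family form (hypothesis `hSMO`: two cuspidal representations with a common Satake
family off a finite set coincide; e.g.
`CuspidalAutomorphicRepGL.eq_of_isSatakeFamilyOf_of_jacquetShalika`). Proof: `A` is a common
Satake family of `Π` and `U_σ(Π)` off a finite set (`IsSatakeFamilyOf.galConj`).
[cite: ArthurClozelAMS120, Ch. 3, §2 (2.4)] -/
theorem CuspidalAutomorphicRepGL.isGalStable_of_isSatakeFamilyOf_smul
    (hSMO : ∀ {P P' : CuspidalAutomorphicRepGL n E ν} {S : Set (HeightOneSpectrum (𝓞 E))},
      S.Finite → ∀ {α : SatakeFamily E}, IsSatakeFamilyOf P S α → IsSatakeFamilyOf P' S α → P = P')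
    (Q : CuspidalAutomorphicRepGL n E ν) (hν : IsGalInvariant F ν) (σ : E ≃ₐ[F] E)
    {S : Set (HeightOneSpectrum (𝓞 E))} (hS : S.Finite) {A : SatakeFamily E}
    (hA : IsSatakeFamilyOf Q S A) (hσ : ∀ᶠ w in cofinite, A (σ⁻¹ • w) = A w) :
    Q.IsGalStable F hν σ := by
  set T : Set (HeightOneSpectrum (𝓞 E)) :=
    S ∪ ((σ⁻¹ • ·) ⁻¹' S) ∪ {w | ¬ A (σ⁻¹ • w) = A w}
  have hTfin : T.Finite :=
    ((hS.union (hS.preimage (MulAction.injective σ⁻¹).injOn)).union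
      (Filter.eventually_cofinite.1 hσ))
  have h1 : IsSatakeFamilyOf Q T A := hA.mono fun w hw => Or.inl (Or.inl hw)
  have h2 : IsSatakeFamilyOf (Q.galConj F hν σ) T A := by
    intro w hw
    have hwS : σ⁻¹ • w ∉ S := fun h => hw (Or.inl (Or.inr h))
    have hAw : A (σ⁻¹ • w) = A w := not_not.mp fun h => hw (Or.inr h)
    obtain ⟨𝔫, h𝔫, hdvd, ϖ, h⟩ := hA.galConj F hν σ w hwS
    exact ⟨𝔫, h𝔫, hdvd, ϖ, hAw ▸ h⟩
  exact hSMO hTfin h2 h1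

variable [NumberField F]

/-- **`σ`-stability of the unitary normalisation** (Arthur–Clozel 1989, Ch. 3, Thm. 4.2 (d),
hypothesis "`Π` cuspidal, `Π ≅ Π ∘ σ`", for a Borel–Jacquet datum). Let `Π` be a cuspidal automorphic
representation of `GL_n(𝔸_E)` in the Borel–Jacquet model whose Satake data are `Gal(E/F)`-stable
almost everywhere (`IsGaloisStableSatakeAE`), and let `Q ≤ L²_cusp(GL_n(𝔸_E) ⧸ A_G GL_n(E), ν)` with a
Satake family `A` off a finite `S` be a unitary normalisation of `Π`: the Satake parameters of `Π` at
`w ∉ S` are exactly `q_w^{s} A(w)`. Granting strong multiplicity one over `E` in Satake-family form,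
`Q` is `σ`-stable for every `σ ∈ Gal(E/F)`: `q_{σ⁻¹ w} = q_w` and `σ⁻¹ w`, `w` lie over the same place
of `F`, so `A (σ⁻¹ w) = A w` almost everywhere, and `isGalStable_of_isSatakeFamilyOf_smul` applies.
[cite: ArthurClozelAMS120, Ch. 3, Thm. 4.2 (d)] -/
theorem CuspidalAutomorphicRepData.isGalStable_of_satake_eq_cpow_mul
    {hE : isCompact_glFiniteIntegralLevel n E}
    (hSMO : ∀ {P P' : CuspidalAutomorphicRepGL n E ν} {S : Set (HeightOneSpectrum (𝓞 E))},
      S.Finite → ∀ {α : SatakeFamily E}, IsSatakeFamilyOf P S α → IsSatakeFamilyOf P' S α → P = P')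
    (hν : IsGalInvariant F ν) (P : CuspidalAutomorphicRepData n E hE)
    (hGal : IsGaloisStableSatakeAE F P.1) {s : ℂ} {Q : CuspidalAutomorphicRepGL n E ν}
    {S : Set (HeightOneSpectrum (𝓞 E))} {A : SatakeFamily E} (hS : S.Finite)
    (hA : IsSatakeFamilyOf Q S A)
    (hiff : ∀ w ∉ S, ∀ β : Multiset ℂ,
      P.1.HasSatakeParamAt w β ↔ β = (A w).map (((w.residueCard : ℂ) ^ s) * ·))
    (σ : E ≃ₐ[F] E) : Q.IsGalStable F hν σ := by
  refine Q.isGalStable_of_isSatakeFamilyOf_smul F hSMO hν σ hS hA ?_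
  have hS' : ∀ᶠ w : HeightOneSpectrum (𝓞 E) in cofinite, w ∉ S := hS.eventually_cofinite_notMem
  have hS'' : ∀ᶠ w : HeightOneSpectrum (𝓞 E) in cofinite, σ⁻¹ • w ∉ S :=
    (tendsto_inv_smul_cofinite (𝓞 E) σ).eventually hS'
  filter_upwards [hGal, hS', hS''] with w hw hwS hwS'
  have hu : (σ⁻¹ • w).asIdeal.under (𝓞 F) = w.asIdeal.under (𝓞 F) :=
    congrArg HeightOneSpectrum.asIdeal (HeightOneSpectrum.under_algEquiv_smul F E σ⁻¹ w)
  have hP : P.1.HasSatakeParamAt w ((A w).map (((w.residueCard : ℂ) ^ s) * ·)) :=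
    (hiff w hwS _).2 rfl
  have h2 := (hiff (σ⁻¹ • w) hwS' _).1 (hw (σ⁻¹ • w) hu _ hP)
  rw [residueCard_smul F σ⁻¹ w] at h2
  have hq : (w.residueCard : ℂ) ≠ 0 := by
    have := w.one_lt_residueCard
    exact_mod_cast (by omega : w.residueCard ≠ 0)
  have hc : (w.residueCard : ℂ) ^ s ≠ 0 := fun h0 => hq ((Complex.cpow_eq_zero_iff _ _).1 h0).1
  exact (Multiset.map_injective (mul_right_injective₀ hc) h2).symm

/-- **"We may assume `Π` unitary", with `σ`-stability** (Arthur–Clozel 1989, Ch. 3, Thm. 4.2 (d),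
hypothesis "`Π` cuspidal, `Π ≅ Π ∘ σ`", for a Borel–Jacquet datum). Let `Π` be a cuspidal
automorphic representation of `GL_n(𝔸_E)` in the Borel–Jacquet model (`n ≥ 1`, any central
character) whose Satake data are `Gal(E/F)`-stable almost everywhere (`IsGaloisStableSatakeAE`).
Granting the Borel–Jacquet dictionary (`exists_isAssociatedL2`, `hasSatakeParamAt_iff_L2`,
`cuspidal_W'_eq_bot`) and strong multiplicity one over `E` in Satake-family form, there are
`s ∈ ℂ` and a cuspidal `Q ≤ L²_cusp(GL_n(𝔸_E) ⧸ A_G GL_n(E), ν)`, **`σ`-stable for every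
`σ ∈ Gal(E/F)`**, with a Satake family `A` off a finite `S` such that the Satake parameters of `Π`
at `w ∉ S` are exactly `q_w^{s} A(w)` (`CuspidalAutomorphicRepData.exists_satake_eq_cpow_mul_L2`);
`σ`-stability by `isGalStable_of_satake_eq_cpow_mul`. **Caveat.** The hypothesis
`hcl : cuspidal_W'_eq_bot hE` (a stable *complement* of `W'`) is refuted in the tree for `n = 1`
(`AutomorphicRepsGLLogDetCounterexample`); the live form is
`exists_satake_eq_cpow_mul_L2_isGalStable_of_clean`. [cite: ArthurClozelAMS120, Ch. 3, Thm. 4.2 (d)] -/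
theorem CuspidalAutomorphicRepData.exists_satake_eq_cpow_mul_L2_isGalStable [NeZero n]
    {hE : isCompact_glFiniteIntegralLevel n E}
    (hSMO : ∀ {P P' : CuspidalAutomorphicRepGL n E ν} {S : Set (HeightOneSpectrum (𝓞 E))},
      S.Finite → ∀ {α : SatakeFamily E}, IsSatakeFamilyOf P S α → IsSatakeFamilyOf P' S α → P = P')
    (hAss : AutomorphicRepsGL.exists_isAssociatedL2 hE ν) (hL2 : hasSatakeParamAt_iff_L2 hE ν)
    (hcl : cuspidal_W'_eq_bot hE) (hν : IsGalInvariant F ν) (P : CuspidalAutomorphicRepData n E hE)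
    (hGal : IsGaloisStableSatakeAE F P.1) :
    ∃ (s : ℂ) (Q : CuspidalAutomorphicRepGL n E ν) (S : Set (HeightOneSpectrum (𝓞 E)))
      (A : SatakeFamily E), S.Finite ∧ IsSatakeFamilyOf Q S A ∧
      (∀ σ : E ≃ₐ[F] E, Q.IsGalStable F hν σ) ∧
      ∀ w ∉ S, ∀ β : Multiset ℂ,
        P.1.HasSatakeParamAt w β ↔ β = (A w).map (((w.residueCard : ℂ) ^ s) * ·) := by
  obtain ⟨s, Q, S, A, hS, hA, hiff⟩ :=
    CuspidalAutomorphicRepData.exists_satake_eq_cpow_mul_L2 hAss hL2 hcl P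
  exact ⟨s, Q, S, A, hS, hA,
    fun σ => P.isGalStable_of_satake_eq_cpow_mul F hSMO hν hGal hS hA hiff σ, hiff⟩

/-- **"We may assume `Π` unitary", with `σ`-stability — clean-model form** (Arthur–Clozel 1989,
Ch. 3, Thm. 4.2 (d), hypothesis "`Π` cuspidal, `Π ≅ Π ∘ σ`", for a Borel–Jacquet datum). Let `Π` be a
cuspidal automorphic representation of `GL_n(𝔸_E)` in the Borel–Jacquet model (`n ≥ 1`, any central
character) with `Gal(E/F)`-stable Satake data, having the Satake parameters of a clean cuspidal datum
`Π₀ = W₀ / ⊥`. Granting the Borel–Jacquet dictionary for `A_G`-invariant data (`exists_isAssociatedL2`,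
`hasSatakeParamAt_iff_L2`) and strong multiplicity one over `E` in Satake-family form, there are
`s ∈ ℂ` and a cuspidal `Q ≤ L²_cusp(GL_n(𝔸_E) ⧸ A_G GL_n(E), ν)`, `σ`-stable for every `σ ∈ Gal(E/F)`,
with a Satake family `A` off a finite `S` such that the Satake parameters of `Π` at `w ∉ S` are exactly
`q_w^{s} A(w)` (`CuspidalAutomorphicRepData.exists_satake_eq_cpow_mul_L2_of_clean` and
`isGalStable_of_satake_eq_cpow_mul`). [cite: ArthurClozelAMS120, Ch. 3, Thm. 4.2 (d)] -/
theorem CuspidalAutomorphicRepData.exists_satake_eq_cpow_mul_L2_isGalStable_of_clean [NeZero n]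
    {hE : isCompact_glFiniteIntegralLevel n E}
    (hSMO : ∀ {P P' : CuspidalAutomorphicRepGL n E ν} {S : Set (HeightOneSpectrum (𝓞 E))},
      S.Finite → ∀ {α : SatakeFamily E}, IsSatakeFamilyOf P S α → IsSatakeFamilyOf P' S α → P = P')
    (hAss : AutomorphicRepsGL.exists_isAssociatedL2 hE ν) (hL2 : hasSatakeParamAt_iff_L2 hE ν)
    (hν : IsGalInvariant F ν) (P P₀ : CuspidalAutomorphicRepData n E hE) (h0W' : P₀.1.W' = ⊥)
    (h0P : ∀ (w : HeightOneSpectrum (𝓞 E)) (β : Multiset ℂ),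
      P₀.1.HasSatakeParamAt w β → P.1.HasSatakeParamAt w β)
    (hGal : IsGaloisStableSatakeAE F P.1) :
    ∃ (s : ℂ) (Q : CuspidalAutomorphicRepGL n E ν) (S : Set (HeightOneSpectrum (𝓞 E)))
      (A : SatakeFamily E), S.Finite ∧ IsSatakeFamilyOf Q S A ∧
      (∀ σ : E ≃ₐ[F] E, Q.IsGalStable F hν σ) ∧
      ∀ w ∉ S, ∀ β : Multiset ℂ,
        P.1.HasSatakeParamAt w β ↔ β = (A w).map (((w.residueCard : ℂ) ^ s) * ·) := by
  obtain ⟨s, Q, S, A, hS, hA, hiff⟩ :=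
    CuspidalAutomorphicRepData.exists_satake_eq_cpow_mul_L2_of_clean hAss hL2 P P₀ h0W' h0P
  exact ⟨s, Q, S, A, hS, hA,
    fun σ => P.isGalStable_of_satake_eq_cpow_mul F hSMO hν hGal hS hA hiff σ, hiff⟩

end GalConj

/-! ### The named fact from the leaves -/

/-- **Arthur–Clozel, Ch. 3, Thm. 4.2 (d) (existence clause) for Borel–Jacquet data — the core
reduction: the named fact `cuspidal_descent_cyclic` of `TunnellOctahedralGlobal` from its `L²` twin,
strong multiplicity one, the Borel–Jacquet dictionary `L²_cusp ↦` cuspidal data, and the unitary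
normalisation of cuspidal data** ("Assume `Π` is cuspidal, `Π ≅ Π ∘ σ`. Then there is `π` cuspidal
lifting to `Π`", Arthur–Clozel 1989, Ch. 3, Thm. 4.2 (d); `E/F` cyclic of prime degree). Granting,
for all `GL_n` over all number fields: the `L²` rendering
`ArthurClozel1989_exists_cuspidal_descent_of_isGalStable` of the same clause (`hdesc`), multiplicity
one on `L²_cusp` (`hm1`) and Jacquet–Shalika (2.2), (2.3) (`h22`, `h23`) — together strong
multiplicity one over `E` —, the Borel–Jacquet dictionary from `L²_cusp` to cuspidal data (`hB`
realisation, `hL2` agreement of Satake parameters) and the unitary normalisation "We may assume `Π`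
unitary" for `n ≥ 1` (`hN`: the Satake parameters of a cuspidal datum off a finite set are exactly
`q_w^{s} t_{Q,w}` for some cuspidal `Q ≤ L²_cusp(GL_n(𝔸) ⧸ A_G GL_n)`; Borel–Jacquet 1979, 5.7;
Arthur–Clozel, proof of Thm. 3.1 — supplied by `CuspidalAutomorphicRepData.exists_satake_eq_cpow_mul_L2_of_clean`
from clean models): every cuspidal `Π` on `GL_n(𝔸_E)` (Borel–Jacquet datum, any central character)
with `Gal(E/F)`-stable Satake data is a weak base-change lift (Def. 1.1) of a cuspidal `π` on
`GL_n(𝔸_F)`. Proof (`n ≥ 1`): `t_Π = q^{s} t_Q` (`hN`) with `Q` `σ`-stable for all `σ`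
(`isGalStable_of_satake_eq_cpow_mul`); `Q` lifts a cuspidal `P' ≤ L²_cusp` over `F` (`hdesc`),
realised by a datum `π'` (`hB`, `hL2`); with `π = π' ⊗ |det|^{-s}`
(`exists_cuspidalAutomorphicRepData_map_mulChar_detTwist`, `t_{π'} = q^{-s} t_{π}`) one gets, at
almost every `w ∣ v`, `t_{Π,w} = q_w^{s} (q_v^{-s} t_{π,v})^{f(w|v)} = (t_{π,v})^{f(w|v)}`
(`IsWeakBaseChangeLift.eventually_map_pow_eq`, `residueCard_cpow_mul_residueCard_under_cpow_neg_pow`,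
uniqueness of `t_{π',v}`); `n = 0`: Satake parameters are empty.
[cite: ArthurClozelAMS120, Ch. 3, Thm. 4.2 (d)] [cite: JacquetShalika1981, Thm. 4.4] -/
theorem cuspidal_descent_cyclic_of_normalisation
    (hdesc : ∀ {n : ℕ} {F E : Type} [Field F] [NumberField F] [Field E] [NumberField E]
      [Algebra F E], ArthurClozel1989_exists_cuspidal_descent_of_isGalStable (n := n) (F := F) (E := E))
    (hm1 : ∀ (n : ℕ) (K : Type) [Field K] [NumberField K] (μ : Measure (gl n K).automorphicQuotient)
      [(gl n K).IsAutomorphicMeasure μ], multiplicity_one_gl n K μ)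
    (h22 : ∀ {n : ℕ} {K : Type} [Field K] [NumberField K] {μ : Measure (gl n K).automorphicQuotient}
      [(gl n K).IsAutomorphicMeasure μ],
      JacquetShalika1981_partialPairL_at_one_of_ne_conj (n := n) (K := K) (μ := μ))
    (h23 : ∀ {n : ℕ} {K : Type} [Field K] [NumberField K] {μ : Measure (gl n K).automorphicQuotient}
      [(gl n K).IsAutomorphicMeasure μ],
      JacquetShalika1981_partialPairL_pole_of_eq_conj (n := n) (K := K) (μ := μ))
    (hB : ∀ {n : ℕ} {K : Type} [Field K] [NumberField K] (hK : isCompact_glFiniteIntegralLevel n K)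
      (μ : Measure (gl n K).automorphicQuotient) [(gl n K).IsAutomorphicMeasure μ],
      AutomorphicRepsGL.exists_cuspidalRepData_of_L2 hK μ)
    (hL2 : ∀ {n : ℕ} {K : Type} [Field K] [NumberField K] (hK : isCompact_glFiniteIntegralLevel n K)
      (μ : Measure (gl n K).automorphicQuotient) [(gl n K).IsAutomorphicMeasure μ],
      hasSatakeParamAt_iff_L2 hK μ)
    (hN : ∀ {n : ℕ} {K : Type} [Field K] [NumberField K] [NeZero n]
      (hK : isCompact_glFiniteIntegralLevel n K) (μ : Measure (gl n K).automorphicQuotient)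
      [(gl n K).IsAutomorphicMeasure μ] (π : CuspidalAutomorphicRepData n K hK),
      ∃ (s : ℂ) (P : CuspidalAutomorphicRepGL n K μ) (S : Set (HeightOneSpectrum (𝓞 K)))
        (αP : SatakeFamily K), S.Finite ∧ IsSatakeFamilyOf P S αP ∧
        ∀ w ∉ S, ∀ β : Multiset ℂ,
          π.1.HasSatakeParamAt w β ↔ β = (αP w).map (((w.residueCard : ℂ) ^ s) * ·)) :
    cuspidal_descent_cyclic := by
  intro n F E _ _ _ _ _ _ hF hE _hcyc hℓ P hGal
  rcases Nat.eq_zero_or_pos n with hn0 | hn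
  · -- `GL_0`: any cuspidal datum over `F` descends `Π`, all Satake parameters being empty
    subst hn0
    haveI := isAutomorphicMeasure_dirac_gl_zero F ((gl 0 F).toAutomorphicQuotient 1)
    obtain ⟨P₀⟩ := nonempty_cuspidalAutomorphicRepGL_zero F
      (Measure.dirac ((gl 0 F).toAutomorphicQuotient 1))
    obtain ⟨π, -, -⟩ := hB hF _ P₀
    refine ⟨π, ?_⟩
    filter_upwards [AutomorphicRepData.hasSatakeParamAt_cofinite_holds P.1] with w hw v α _ hα
    obtain ⟨β, hβ⟩ := hw
    have h1 : α = 0 := Multiset.card_eq_zero.1 hα.card_eq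
    have h2 : β = 0 := Multiset.card_eq_zero.1 hβ.card_eq
    rw [h1, Multiset.map_zero, ← h2]
    exact hβ
  haveI : NeZero n := ⟨hn.ne'⟩
  -- `E` side: unitary normalisation `Q` of `Π`, `σ`-stable by strong multiplicity one
  obtain ⟨ν, hνA⟩ := AdelicGroupData.exists_isAutomorphicMeasure_gl_holds n E
  haveI := hνA
  have hνG : IsGalInvariant F ν :=
    isGalInvariant_of_unique F (isAutomorphicMeasure_unique_smul_holds n E) ν
  have hSMO : ∀ {Q Q' : CuspidalAutomorphicRepGL n E ν} {S : Set (HeightOneSpectrum (𝓞 E))},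
      S.Finite → ∀ {α : SatakeFamily E}, IsSatakeFamilyOf Q S α → IsSatakeFamilyOf Q' S α →
        Q = Q' :=
    fun hS _ h1 h2 =>
      CuspidalAutomorphicRepGL.eq_of_isSatakeFamilyOf_of_jacquetShalika hn (hm1 n E ν) h22 h23
        hS h1 h2
  obtain ⟨s, Q, S, A, hS, hAQ, hiff⟩ := hN hE ν P
  have hQst : ∀ σ : E ≃ₐ[F] E, Q.IsGalStable F hνG σ := fun σ =>
    P.isGalStable_of_satake_eq_cpow_mul F hSMO hνG hGal hS hAQ hiff σ
  -- descent in `L²` (the named fact)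
  obtain ⟨μ', hμ'A, P', hlift⟩ := hdesc hℓ ν hνG Q hQst
  haveI := hμ'A
  -- `F` side: a datum `π'` realising `P'`, its Satake family, and the twist `π = π' ⊗ |det|^{-s}`
  obtain ⟨π', -, hass⟩ := hB hF μ' P'
  obtain ⟨S₁, β, -, hβ⟩ := exists_isSatakeFamilyOf_holds (n := n) (K := F) (μ := μ') P'
  obtain ⟨χ, hχ⟩ := exists_heckeCharacter_ideleNorm_cpow F s
  obtain ⟨π, hπW, hπW'⟩ :=
    exists_cuspidalAutomorphicRepData_map_mulChar_detTwist (inv_apply_of_cpow hχ) π'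
  have hπ'W : π'.1.W = π.1.W.map (mulChar (detTwist n χ)) := by
    rw [hπW, detTwist_inv, map_mulChar_map_mulChar_inv]
  have hπ'W' : π'.1.W' = π.1.W'.map (mulChar (detTwist n χ)) := by
    rw [hπW', detTwist_inv, map_mulChar_map_mulChar_inv]
  refine ⟨π, ?_⟩
  -- relation (1.1) between the families `β` of `P'` and `A` of `Q`, almost everywhere
  have hrel := hlift.eventually_map_pow_eq hβ hAQ
  have hS' : ∀ᶠ w : HeightOneSpectrum (𝓞 E) in cofinite, w ∉ S := hS.eventually_cofinite_notMem
  have hS₁' : ∀ᶠ w : HeightOneSpectrum (𝓞 E) in cofinite, w.under (𝓞 F) ∉ (S₁ : Set _) :=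
    (tendsto_under_cofinite (𝓞 F)).eventually S₁.eventually_cofinite_notMem
  filter_upwards [hrel, hS', hS₁'] with w hw hwS hwS₁ v α hv hα
  have hv' : w.under (𝓞 F) = v := HeightOneSpectrum.ext hv
  subst hv'
  -- `t_{π', v} = q_v^{-s} t_{π, v}` is the family member `β v`
  have hα' : π'.1.HasSatakeParamAt (w.under (𝓞 F))
      (α.map ((((w.under (𝓞 F)).residueCard : ℂ) ^ (-s)) * ·)) :=
    AutomorphicRepData.HasSatakeParamAt.of_map_mulChar_detTwist_of_cpow hχ hπ'W hπ'W' hα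
  have hβv : π'.1.HasSatakeParamAt (w.under (𝓞 F)) (β (w.under (𝓞 F))) := by
    obtain ⟨𝔫, h𝔫, hv𝔫, ϖ, hSat⟩ := hβ _ hwS₁
    exact (hL2 hF μ' hass _ _).2 ⟨𝔫, ϖ, h𝔫, hv𝔫, hSat⟩
  have heq := AutomorphicRepData.hasSatakeParamAt_unique_holds π'.1 hβv hα'
  -- `t_{Π, w} = q_w^{s} A(w) = q_w^{s} (q_v^{-s} t_{π,v})^{f} = (t_{π,v})^{f}`
  have hPw : P.1.HasSatakeParamAt w ((A w).map (((w.residueCard : ℂ) ^ s) * ·)) :=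
    (hiff w hwS _).2 rfl
  rw [hw hwS₁ hwS, heq, Multiset.map_map, Multiset.map_map] at hPw
  have hmap : α.map (· ^ w.asIdeal.inertiaDeg (𝓞 F)) =
      α.map ((((fun x => (w.residueCard : ℂ) ^ s * x) ∘ fun x => x ^ w.asIdeal.inertiaDeg (𝓞 F)) ∘
        fun x => (((w.under (𝓞 F)).residueCard : ℂ) ^ (-s)) * x)) := by
    refine Multiset.map_congr rfl fun a _ => ?_
    simp only [Function.comp_apply]
    rw [mul_pow, ← mul_assoc, residueCard_cpow_mul_residueCard_under_cpow_neg_pow, one_mul]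
  rw [hmap]
  exact hPw

/-- **Arthur–Clozel, Ch. 3, Thm. 4.2 (d) (existence clause) for Borel–Jacquet data: the named fact
`cuspidal_descent_cyclic` of `TunnellOctahedralGlobal` from its `L²` twin and the standard
leaves** ("Assume `Π` is cuspidal, `Π ≅ Π ∘ σ`. Then there is `π` cuspidal lifting to `Π`",
Arthur–Clozel 1989, Ch. 3, Thm. 4.2 (d); `E/F` cyclic of prime degree). Granting, for all `GL_n`
over all number fields: the `L²` rendering `ArthurClozel1989_exists_cuspidal_descent_of_isGalStable`
of the same clause (`hdesc`), multiplicity one on `L²_cusp` (`hm1`) and Jacquet–Shalika (2.2), (2.3)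
(`h22`, `h23`) — together strong multiplicity one over `E` —, and the Borel–Jacquet dictionary
(`hA` cuspidal data ↦ `L²_cusp`, `hB` `L²_cusp` ↦ cuspidal data, `hL2` agreement of Satake
parameters, `hcl` realisation on a subspace): every cuspidal `Π` on `GL_n(𝔸_E)` (Borel–Jacquet
datum, any central character) with `Gal(E/F)`-stable Satake data is a weak base-change lift
(Def. 1.1) of a cuspidal `π` on `GL_n(𝔸_F)`. Proof (`n ≥ 1`): `t_Π = q^{s} t_Q` with
`Q ≤ L²_cusp(GL_n(𝔸_E) ⧸ A_G GL_n(E))` `σ`-stable for all `σ`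
(`exists_satake_eq_cpow_mul_L2_isGalStable`); `Q` lifts a cuspidal `P' ≤ L²_cusp` over `F`
(`hdesc`), realised by a datum `π'` (`hB`, `hL2`); with `π = π' ⊗ |det|^{-s}`
(`exists_cuspidalAutomorphicRepData_map_mulChar_detTwist`, `t_{π'} = q^{-s} t_{π}`) one gets, at
almost every `w ∣ v`, `t_{Π,w} = q_w^{s} (q_v^{-s} t_{π,v})^{f(w|v)} = (t_{π,v})^{f(w|v)}`
(`IsWeakBaseChangeLift.eventually_map_pow_eq`, `residueCard_cpow_mul_residueCard_under_cpow_neg_pow`,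
uniqueness of `t_{π',v}`); `n = 0`: Satake parameters are empty. By
`cuspidal_descent_cyclic_of_normalisation` with `hN` from
`CuspidalAutomorphicRepData.exists_satake_eq_cpow_mul_L2` (`hA`, `hL2`, `hcl`). **Caveat.** The family
hypothesis `hcl` (`cuspidal_W'_eq_bot` for all `GL_n`: a stable *complement* of `W'`) is refuted in the
tree (`not_forall_cuspidal_W'_eq_bot` of `AutomorphicRepsGLLogDetCounterexample`: on `GL_1` the cuspidal
datum `span {log ‖·‖_𝔸, 1} / ℂ·1` has no stable complement), so this first form is vacuous; the live
form is `cuspidal_descent_cyclic_of_clean_leaves` (clean models instead of complements).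
[cite: ArthurClozelAMS120, Ch. 3, Thm. 4.2 (d)] [cite: JacquetShalika1981, Thm. 4.4] -/
theorem cuspidal_descent_cyclic_of_leaves
    (hdesc : ∀ {n : ℕ} {F E : Type} [Field F] [NumberField F] [Field E] [NumberField E]
      [Algebra F E], ArthurClozel1989_exists_cuspidal_descent_of_isGalStable (n := n) (F := F) (E := E))
    (hm1 : ∀ (n : ℕ) (K : Type) [Field K] [NumberField K] (μ : Measure (gl n K).automorphicQuotient)
      [(gl n K).IsAutomorphicMeasure μ], multiplicity_one_gl n K μ)
    (h22 : ∀ {n : ℕ} {K : Type} [Field K] [NumberField K] {μ : Measure (gl n K).automorphicQuotient}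
      [(gl n K).IsAutomorphicMeasure μ],
      JacquetShalika1981_partialPairL_at_one_of_ne_conj (n := n) (K := K) (μ := μ))
    (h23 : ∀ {n : ℕ} {K : Type} [Field K] [NumberField K] {μ : Measure (gl n K).automorphicQuotient}
      [(gl n K).IsAutomorphicMeasure μ],
      JacquetShalika1981_partialPairL_pole_of_eq_conj (n := n) (K := K) (μ := μ))
    (hA : ∀ {n : ℕ} {K : Type} [Field K] [NumberField K] (hK : isCompact_glFiniteIntegralLevel n K)
      (μ : Measure (gl n K).automorphicQuotient) [(gl n K).IsAutomorphicMeasure μ],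
      AutomorphicRepsGL.exists_isAssociatedL2 hK μ)
    (hB : ∀ {n : ℕ} {K : Type} [Field K] [NumberField K] (hK : isCompact_glFiniteIntegralLevel n K)
      (μ : Measure (gl n K).automorphicQuotient) [(gl n K).IsAutomorphicMeasure μ],
      AutomorphicRepsGL.exists_cuspidalRepData_of_L2 hK μ)
    (hL2 : ∀ {n : ℕ} {K : Type} [Field K] [NumberField K] (hK : isCompact_glFiniteIntegralLevel n K)
      (μ : Measure (gl n K).automorphicQuotient) [(gl n K).IsAutomorphicMeasure μ],
      hasSatakeParamAt_iff_L2 hK μ)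
    (hcl : ∀ {n : ℕ} {K : Type} [Field K] [NumberField K] (hK : isCompact_glFiniteIntegralLevel n K),
      cuspidal_W'_eq_bot hK) :
    cuspidal_descent_cyclic :=
  cuspidal_descent_cyclic_of_normalisation hdesc hm1 h22 h23 hB hL2
    (fun hK μ _ π => CuspidalAutomorphicRepData.exists_satake_eq_cpow_mul_L2 (hA hK μ) (hL2 hK μ)
      (hcl hK) π)

/-- **Arthur–Clozel, Ch. 3, Thm. 4.2 (d) (existence clause) for Borel–Jacquet data from the leaves —
live form with clean models.** Granting, for all `GL_n` over all number fields: the `L²` rendering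
`ArthurClozel1989_exists_cuspidal_descent_of_isGalStable` of the clause (`hdesc`), multiplicity one on
`L²_cusp` (`hm1`), Jacquet–Shalika (2.2), (2.3) (`h22`, `h23`), the Borel–Jacquet dictionary (`hA`
`A_G`-invariant cuspidal data ↦ `L²_cusp`, `hB` `L²_cusp` ↦ cuspidal data, `hL2` agreement of Satake
parameters; Borel–Jacquet 1979, 4.4–4.6, 5.7) and clean models for `n ≥ 1` (`hcl`: every cuspidal
datum `π` has the Satake parameters of a cuspidal datum `π₀` realised on a subspace, `W₀' = ⊥` — the
weak, true form shared with `JacquetShalika_eq_of_rsData_eq_of_L2` and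
`ArthurClozel_fibres_quadratic_of_leaves'`, a theorem granted the semisimplicity of `A_G`-invariant cusp
forms, the named fact `AutomorphicRepsGL.stable_cuspidal_eq_sSup_irreducible`:
`CuspidalAutomorphicRepData.exists_clean_hasSatakeParamAt_of_sSup_irreducible` of
`AutomorphicRepsGLCleanModel`): every cuspidal `Π` on
`GL_n(𝔸_E)` (Borel–Jacquet datum, any central character; `E/F` cyclic of prime degree) with
`Gal(E/F)`-stable Satake data is a weak base-change lift of a cuspidal `π` on `GL_n(𝔸_F)` — the named
fact `cuspidal_descent_cyclic`. By `cuspidal_descent_cyclic_of_normalisation` with `hN` from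
`CuspidalAutomorphicRepData.exists_satake_eq_cpow_mul_L2_of_clean`. So `cuspidal_descent_cyclic_holds`
is this theorem fed with the discharges of the seven named leaves and the clean models
(`exists_clean_hasSatakeParamAt_of_sSup_irreducible` with the discharge of
`stable_cuspidal_eq_sSup_irreducible`), once they exist.
[cite: ArthurClozelAMS120, Ch. 3, Thm. 4.2 (d)] [cite: BorelJacquetCorvallis1979, §4.6 and 5.7] -/
theorem cuspidal_descent_cyclic_of_clean_leaves
    (hdesc : ∀ {n : ℕ} {F E : Type} [Field F] [NumberField F] [Field E] [NumberField E]
      [Algebra F E], ArthurClozel1989_exists_cuspidal_descent_of_isGalStable (n := n) (F := F) (E := E))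
    (hm1 : ∀ (n : ℕ) (K : Type) [Field K] [NumberField K] (μ : Measure (gl n K).automorphicQuotient)
      [(gl n K).IsAutomorphicMeasure μ], multiplicity_one_gl n K μ)
    (h22 : ∀ {n : ℕ} {K : Type} [Field K] [NumberField K] {μ : Measure (gl n K).automorphicQuotient}
      [(gl n K).IsAutomorphicMeasure μ],
      JacquetShalika1981_partialPairL_at_one_of_ne_conj (n := n) (K := K) (μ := μ))
    (h23 : ∀ {n : ℕ} {K : Type} [Field K] [NumberField K] {μ : Measure (gl n K).automorphicQuotient}
      [(gl n K).IsAutomorphicMeasure μ],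
      JacquetShalika1981_partialPairL_pole_of_eq_conj (n := n) (K := K) (μ := μ))
    (hA : ∀ {n : ℕ} {K : Type} [Field K] [NumberField K] (hK : isCompact_glFiniteIntegralLevel n K)
      (μ : Measure (gl n K).automorphicQuotient) [(gl n K).IsAutomorphicMeasure μ],
      AutomorphicRepsGL.exists_isAssociatedL2 hK μ)
    (hB : ∀ {n : ℕ} {K : Type} [Field K] [NumberField K] (hK : isCompact_glFiniteIntegralLevel n K)
      (μ : Measure (gl n K).automorphicQuotient) [(gl n K).IsAutomorphicMeasure μ],
      AutomorphicRepsGL.exists_cuspidalRepData_of_L2 hK μ)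
    (hL2 : ∀ {n : ℕ} {K : Type} [Field K] [NumberField K] (hK : isCompact_glFiniteIntegralLevel n K)
      (μ : Measure (gl n K).automorphicQuotient) [(gl n K).IsAutomorphicMeasure μ],
      hasSatakeParamAt_iff_L2 hK μ)
    (hcl : ∀ {n : ℕ} {K : Type} [Field K] [NumberField K] [NeZero n]
      (hK : isCompact_glFiniteIntegralLevel n K) (π : CuspidalAutomorphicRepData n K hK),
      ∃ π₀ : CuspidalAutomorphicRepData n K hK, π₀.1.W' = ⊥ ∧
        ∀ (v : HeightOneSpectrum (𝓞 K)) (β : Multiset ℂ),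
          π₀.1.HasSatakeParamAt v β → π.1.HasSatakeParamAt v β) :
    cuspidal_descent_cyclic :=
  cuspidal_descent_cyclic_of_normalisation hdesc hm1 h22 h23 hB hL2
    (fun hK μ _ π => by
      obtain ⟨π₀, h0W', h0π⟩ := hcl hK π
      exact CuspidalAutomorphicRepData.exists_satake_eq_cpow_mul_L2_of_clean (hA hK μ) (hL2 hK μ) π π₀
        h0W' h0π)

end Literature.NumberTheory.Automorphic
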